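import Mathlib
import HarnessLib

/-!
# Venture HSemireg — the defect-pairing form of the cubic supertrace law (W³)

HONEST FRAMING. Lean leaf for the computation cell `pub-hsemireg` (target seat t-5 gen 18; file of record
`run/shared/lean/pub/pub-hsemireg/target-g6/W3-YLAW-t5g18.md`, building on
`target-g6/W3-LAWS-t5g17.md` and th-3's `theory/TH3-SIGMA-ORBIT-PROOF.md` §5, §7). In the minimal twisted-complex
model of a «reduced-point complex» on a smooth threefold germ, a W-class has even components `B₀, B₁, B₂` and odd
potentials `W₀, W₁, W₂` tied to the three odd gluing operators `u₀, u₁, u₂` by the Killing relation (E1)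
`u_l W_j + W_j u_l = ε_{jli} B_i` (so `{u_l,W_l} = 0`, `{u₀,W₁} = -B₂`, `{u₀,W₂} = B₁`, and cyclically), and by the
closedness relation (E2) `Σ_l (u_l B_l - B_l u_l) = 0`. For three classes `B, B′, B″` the cubic form is
`T = Σ_l (B × B′)_l B″_l` with `(B × B′)₀ = B₁B′₂ - B₂B′₁` (cyclically), and Conjecture (W³) says `str T = 0`.

THIS FILE kernel-checks three finite identities found by t-5 g18 (all operators in a ring, resp. in the endomorphism
ring `Module.End F U` of the total space with parity operator `σ`, `str X = trace (σ X)`):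
1. `crossComponent_eq_defectPairing_sub_anticomm` — using ONLY the three Killing relations of the SECOND class at
   the direction `u`: `(B × B′)_l = Y_l - {u_l, E}` with the DEFECT PAIRING `Y_l := Σ_i (u_l B_i - B_i u_l) W′_i`
   (defects of the first class times potentials of the second) and `E := Σ_i B_i W′_i` (any ring);
2. `supertrace_sum_anticomm_mul_eq_zero_of_divergence_eq_zero` — `Σ_l str({u_l,E} P_l) = 0` whenever
   `Σ_l (u_l P_l - P_l u_l) = 0` ((E2) of the third class) and `σ` anticommutes with the `u_l`;
3. `supertrace_cubicForm_eq_supertrace_defectPairing` — hence `str T = Σ_l str(Y_l B″_l)` exactly: (W³) is the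
   statement that the defect-pairing vector `Y(κ,κ′)` pairs to zero with every W-class; in particular
   `supertrace_cubicForm_eq_zero_of_defectPairing_eq_zero`: the law (Y) «`Y_l = 0` for all `l`» — OBSERVED on every
   bed of the cell (float and exact) but shown NOT to be a formal consequence of (E1),(E2) and to FAIL on other
   instances (W3-YLAW-t5g18 §3) — implies `str T = 0`, and (`crossComponent_eq_neg_anticomm_of_defectPairing_eq_zero`)
   makes every cross product a δ-coboundary with the single witness `-E` (W·W exact).
The model, the meaning of W-classes, the law (Y) and everything about HC are NOT formalised; nothing here says (W³) is
proved; no object is constructed; nothing here bears on HC, HC_CM or HC_AV.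
-/

namespace Summit.Ventures.HSemireg

open LinearMap

/-- **Cross product = defect pairing minus an anticommutator** (t-5 g18, W3-YLAW §1; any ring). With the three
Killing relations of the second class at the odd direction `u` — `u W₀ + W₀ u = 0`, `u W₁ + W₁ u = -C₂`,
`u W₂ + W₂ u = C₁` (for `u = u₀` these are `{u₀,W′₀} = 0`, `{u₀,W′₁} = -B′₂`, `{u₀,W′₂} = B′₁`) — the cross-product
component `B₁ C₂ - B₂ C₁ = (B × B′)₀` equals the defect pairing `Σ_i [u,B_i] W_i` minus the anticommutator
`{u, Σ_i B_i W_i}`. The other two components follow by the cyclic relabelling `0 → 1 → 2 → 0` of all indices.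
Proof: the right-hand side collapses to `-Σ_i B_i {u, W_i}`. [folklore] -/
theorem crossComponent_eq_defectPairing_sub_anticomm {R : Type*} [Ring R]
    (u B₀ B₁ B₂ W₀ W₁ W₂ C₁ C₂ : R)
    (h0 : u * W₀ + W₀ * u = 0) (h1 : u * W₁ + W₁ * u = -C₂) (h2 : u * W₂ + W₂ * u = C₁) :
    B₁ * C₂ - B₂ * C₁
      = ((u * B₀ - B₀ * u) * W₀ + (u * B₁ - B₁ * u) * W₁ + (u * B₂ - B₂ * u) * W₂)
        - (u * (B₀ * W₀ + B₁ * W₁ + B₂ * W₂) + (B₀ * W₀ + B₁ * W₁ + B₂ * W₂) * u) := by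
  have key : ((u * B₀ - B₀ * u) * W₀ + (u * B₁ - B₁ * u) * W₁ + (u * B₂ - B₂ * u) * W₂)
        - (u * (B₀ * W₀ + B₁ * W₁ + B₂ * W₂) + (B₀ * W₀ + B₁ * W₁ + B₂ * W₂) * u)
      = -(B₀ * (u * W₀ + W₀ * u) + B₁ * (u * W₁ + W₁ * u) + B₂ * (u * W₂ + W₂ * u)) := by
    noncomm_ring
  rw [key, h0, h1, h2]
  noncomm_ring

/-- **W·W is a coboundary when the defect pairings vanish** (t-5 g18, W3-YLAW §2; any ring). Under the same three
Killing relations, if the defect pairing `Σ_i [u,B_i] W_i` vanishes (the law (Y) at the direction `u`, observed on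
every bed of the cell and NOT a theorem in general) then `(B × B′)₀ = -{u, E}` with the explicit witness
`E = Σ_i B_i W_i` — the cross product is `δ_u`-exact. [folklore] -/
theorem crossComponent_eq_neg_anticomm_of_defectPairing_eq_zero {R : Type*} [Ring R]
    (u B₀ B₁ B₂ W₀ W₁ W₂ C₁ C₂ : R)
    (h0 : u * W₀ + W₀ * u = 0) (h1 : u * W₁ + W₁ * u = -C₂) (h2 : u * W₂ + W₂ * u = C₁)
    (hY : (u * B₀ - B₀ * u) * W₀ + (u * B₁ - B₁ * u) * W₁ + (u * B₂ - B₂ * u) * W₂ = 0) :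
    B₁ * C₂ - B₂ * C₁
      = -(u * (B₀ * W₀ + B₁ * W₁ + B₂ * W₂) + (B₀ * W₀ + B₁ * W₁ + B₂ * W₂) * u) := by
  rw [crossComponent_eq_defectPairing_sub_anticomm u B₀ B₁ B₂ W₀ W₁ W₂ C₁ C₂ h0 h1 h2, hY, zero_sub]

variable {F : Type*} [Field F]
variable {U : Type*} [AddCommGroup U] [Module F U]

/-- **One anticommutator term under the supertrace** (endomorphism-ring form). For a parity operator `σ` with
`σ u = -(u σ)` (u odd) and arbitrary `E`, `P`: `trace (σ (u E + E u) P) = trace (σ E (u P - P u))`, i.e.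
`str({u,E}·P) = str(E·[u,P])`. Proof: `trace (σ u E P) = -trace (u σ E P) = -trace (σ E P u)` by the anticommutation
and cyclicity of the trace. [folklore] -/
theorem supertrace_anticomm_mul_eq_supertrace_mul_comm (σ u E P : Module.End F U)
    (hσu : σ * u = -(u * σ)) :
    LinearMap.trace F U (σ * ((u * E + E * u) * P)) = LinearMap.trace F U (σ * (E * (u * P - P * u))) := by
  have op : σ * u * E * P = -(u * (σ * E * P)) := by
    calc σ * u * E * P = (σ * u) * (E * P) := by noncomm_ring
      _ = (-(u * σ)) * (E * P) := by rw [hσu]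
      _ = -(u * (σ * E * P)) := by noncomm_ring
  have key : LinearMap.trace F U (σ * u * E * P) = -LinearMap.trace F U (σ * E * P * u) := by
    rw [op, map_neg, LinearMap.trace_mul_comm]
  have expandL : σ * ((u * E + E * u) * P) = σ * u * E * P + σ * E * u * P := by noncomm_ring
  have expandR : σ * (E * (u * P - P * u)) = σ * E * u * P - σ * E * P * u := by noncomm_ring
  rw [expandL, expandR, map_add, map_sub, key]
  abel

/-- **The anticommutator terms drop out under (E2) of the third class** (t-5 g18, W3-YLAW §1). For a parity operator
`σ` anticommuting with the three odd gluing operators `u₀ u₁ u₂`, any `E`, and even components `P₀ P₁ P₂` of a third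
class satisfying the closedness relation (E2) `Σ_l (u_l P_l - P_l u_l) = 0`:
`Σ_l str({u_l,E}·P_l) = str(E·Σ_l [u_l,P_l]) = 0`. [folklore] -/
theorem supertrace_sum_anticomm_mul_eq_zero_of_divergence_eq_zero (σ u₀ u₁ u₂ E P₀ P₁ P₂ : Module.End F U)
    (hσ0 : σ * u₀ = -(u₀ * σ)) (hσ1 : σ * u₁ = -(u₁ * σ)) (hσ2 : σ * u₂ = -(u₂ * σ))
    (hdiv : (u₀ * P₀ - P₀ * u₀) + (u₁ * P₁ - P₁ * u₁) + (u₂ * P₂ - P₂ * u₂) = 0) :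
    LinearMap.trace F U (σ * ((u₀ * E + E * u₀) * P₀ + (u₁ * E + E * u₁) * P₁ + (u₂ * E + E * u₂) * P₂))
      = 0 := by
  have expand : σ * ((u₀ * E + E * u₀) * P₀ + (u₁ * E + E * u₁) * P₁ + (u₂ * E + E * u₂) * P₂)
      = σ * ((u₀ * E + E * u₀) * P₀) + σ * ((u₁ * E + E * u₁) * P₁) + σ * ((u₂ * E + E * u₂) * P₂) := by
    noncomm_ring
  rw [expand, map_add, map_add,
    supertrace_anticomm_mul_eq_supertrace_mul_comm σ u₀ E P₀ hσ0,
    supertrace_anticomm_mul_eq_supertrace_mul_comm σ u₁ E P₁ hσ1,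
    supertrace_anticomm_mul_eq_supertrace_mul_comm σ u₂ E P₂ hσ2,
    ← map_add, ← map_add]
  have collect : σ * (E * (u₀ * P₀ - P₀ * u₀)) + σ * (E * (u₁ * P₁ - P₁ * u₁)) + σ * (E * (u₂ * P₂ - P₂ * u₂))
      = σ * E * ((u₀ * P₀ - P₀ * u₀) + (u₁ * P₁ - P₁ * u₁) + (u₂ * P₂ - P₂ * u₂)) := by
    noncomm_ring
  rw [collect, hdiv, mul_zero, map_zero]

/-- **The defect-pairing form of (W³)** (t-5 g18, W3-YLAW §1). Data in the endomorphism ring of the total space of a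
reduced-point complex (any number of levels): parity operator `σ` anticommuting with the odd gluing operators
`u₀ u₁ u₂`; the components `B₀ B₁ B₂` of a first W-class (NO hypothesis on them is needed); the components
`C₀ C₁ C₂` and potentials `W₀ W₁ W₂` of a second class, tied by the nine Killing relations (E1)
`u_l W_j + W_j u_l = ε_{jli} C_i`; the components `P₀ P₁ P₂` of a third class satisfying (E2). Then the cubic form
`T = Σ_l (B × C)_l P_l` has `str T = Σ_l str(Y_l P_l)` with the DEFECT PAIRINGS
`Y_l = Σ_i (u_l B_i - B_i u_l) W_i`. Consequently (W³) ⟺ «`Y(κ,κ′)` pairs to zero with every W-class», `Y` being linear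
in the defects `[u_l,B_i]` (hence in the curvature, by th-3's defect formula) — it vanishes on the flat stratum, which
re-proves th-3's flat-stratum theorem. Nothing here proves (W³). [folklore] -/
theorem supertrace_cubicForm_eq_supertrace_defectPairing
    (σ u₀ u₁ u₂ B₀ B₁ B₂ W₀ W₁ W₂ C₀ C₁ C₂ P₀ P₁ P₂ : Module.End F U)
    (hσ0 : σ * u₀ = -(u₀ * σ)) (hσ1 : σ * u₁ = -(u₁ * σ)) (hσ2 : σ * u₂ = -(u₂ * σ))
    (h00 : u₀ * W₀ + W₀ * u₀ = 0) (h01 : u₀ * W₁ + W₁ * u₀ = -C₂) (h02 : u₀ * W₂ + W₂ * u₀ = C₁)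
    (h11 : u₁ * W₁ + W₁ * u₁ = 0) (h12 : u₁ * W₂ + W₂ * u₁ = -C₀) (h10 : u₁ * W₀ + W₀ * u₁ = C₂)
    (h22 : u₂ * W₂ + W₂ * u₂ = 0) (h20 : u₂ * W₀ + W₀ * u₂ = -C₁) (h21 : u₂ * W₁ + W₁ * u₂ = C₀)
    (hdiv : (u₀ * P₀ - P₀ * u₀) + (u₁ * P₁ - P₁ * u₁) + (u₂ * P₂ - P₂ * u₂) = 0) :
    LinearMap.trace F U (σ * ((B₁ * C₂ - B₂ * C₁) * P₀ + (B₂ * C₀ - B₀ * C₂) * P₁ + (B₀ * C₁ - B₁ * C₀) * P₂))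
      = LinearMap.trace F U (σ * (
          ((u₀ * B₀ - B₀ * u₀) * W₀ + (u₀ * B₁ - B₁ * u₀) * W₁ + (u₀ * B₂ - B₂ * u₀) * W₂) * P₀
        + ((u₁ * B₀ - B₀ * u₁) * W₀ + (u₁ * B₁ - B₁ * u₁) * W₁ + (u₁ * B₂ - B₂ * u₁) * W₂) * P₁
        + ((u₂ * B₀ - B₀ * u₂) * W₀ + (u₂ * B₁ - B₁ * u₂) * W₁ + (u₂ * B₂ - B₂ * u₂) * W₂) * P₂)) := by
  -- the three cross components (cyclic relabellings of the first lemma)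
  have c0 := crossComponent_eq_defectPairing_sub_anticomm u₀ B₀ B₁ B₂ W₀ W₁ W₂ C₁ C₂ h00 h01 h02
  have c1 := crossComponent_eq_defectPairing_sub_anticomm u₁ B₁ B₂ B₀ W₁ W₂ W₀ C₂ C₀ h11 h12 h10
  have c2 := crossComponent_eq_defectPairing_sub_anticomm u₂ B₂ B₀ B₁ W₂ W₀ W₁ C₀ C₁ h22 h20 h21
  set E := B₀ * W₀ + B₁ * W₁ + B₂ * W₂ with hE
  have hE1 : B₁ * W₁ + B₂ * W₂ + B₀ * W₀ = E := by rw [hE]; abel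
  have hE2 : B₂ * W₂ + B₀ * W₀ + B₁ * W₁ = E := by rw [hE]; abel
  rw [hE1] at c1
  rw [hE2] at c2
  set Y₀ := (u₀ * B₀ - B₀ * u₀) * W₀ + (u₀ * B₁ - B₁ * u₀) * W₁ + (u₀ * B₂ - B₂ * u₀) * W₂ with hY₀
  set Y₁ := (u₁ * B₀ - B₀ * u₁) * W₀ + (u₁ * B₁ - B₁ * u₁) * W₁ + (u₁ * B₂ - B₂ * u₁) * W₂ with hY₁
  set Y₂ := (u₂ * B₀ - B₀ * u₂) * W₀ + (u₂ * B₁ - B₁ * u₂) * W₁ + (u₂ * B₂ - B₂ * u₂) * W₂ with hY₂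
  have hY1' : (u₁ * B₁ - B₁ * u₁) * W₁ + (u₁ * B₂ - B₂ * u₁) * W₂ + (u₁ * B₀ - B₀ * u₁) * W₀ = Y₁ := by
    rw [hY₁]; abel
  have hY2' : (u₂ * B₂ - B₂ * u₂) * W₂ + (u₂ * B₀ - B₀ * u₂) * W₀ + (u₂ * B₁ - B₁ * u₂) * W₁ = Y₂ := by
    rw [hY₂]; abel
  rw [hY1'] at c1
  rw [hY2'] at c2
  rw [c0, c1, c2]
  have split : σ * ((Y₀ - (u₀ * E + E * u₀)) * P₀ + (Y₁ - (u₁ * E + E * u₁)) * P₁ + (Y₂ - (u₂ * E + E * u₂)) * P₂)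
      = σ * (Y₀ * P₀ + Y₁ * P₁ + Y₂ * P₂)
        - σ * ((u₀ * E + E * u₀) * P₀ + (u₁ * E + E * u₁) * P₁ + (u₂ * E + E * u₂) * P₂) := by
    noncomm_ring
  rw [split, map_sub, supertrace_sum_anticomm_mul_eq_zero_of_divergence_eq_zero σ u₀ u₁ u₂ E P₀ P₁ P₂
    hσ0 hσ1 hσ2 hdiv, sub_zero]

/-- **(Y) ⇒ (W³)** (t-5 g18, W3-YLAW §2). In the setting of `supertrace_cubicForm_eq_supertrace_defectPairing`,
if the three defect pairings `Y_l = Σ_i [u_l,B_i] W_i` vanish (the law (Y): observed on every float and exact bed of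
the cell, where it makes W·W a coboundary with witness `-Σ_i B_i W_i`; NOT a formal consequence of (E1)∧(E2) and
false on other reduced-point instances, where (W³) is observed to hold by a different mechanism), then `str T = 0`.
Nothing here says (W³) holds in general. [folklore] -/
theorem supertrace_cubicForm_eq_zero_of_defectPairing_eq_zero
    (σ u₀ u₁ u₂ B₀ B₁ B₂ W₀ W₁ W₂ C₀ C₁ C₂ P₀ P₁ P₂ : Module.End F U)
    (hσ0 : σ * u₀ = -(u₀ * σ)) (hσ1 : σ * u₁ = -(u₁ * σ)) (hσ2 : σ * u₂ = -(u₂ * σ))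
    (h00 : u₀ * W₀ + W₀ * u₀ = 0) (h01 : u₀ * W₁ + W₁ * u₀ = -C₂) (h02 : u₀ * W₂ + W₂ * u₀ = C₁)
    (h11 : u₁ * W₁ + W₁ * u₁ = 0) (h12 : u₁ * W₂ + W₂ * u₁ = -C₀) (h10 : u₁ * W₀ + W₀ * u₁ = C₂)
    (h22 : u₂ * W₂ + W₂ * u₂ = 0) (h20 : u₂ * W₀ + W₀ * u₂ = -C₁) (h21 : u₂ * W₁ + W₁ * u₂ = C₀)
    (hdiv : (u₀ * P₀ - P₀ * u₀) + (u₁ * P₁ - P₁ * u₁) + (u₂ * P₂ - P₂ * u₂) = 0)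
    (hY0 : (u₀ * B₀ - B₀ * u₀) * W₀ + (u₀ * B₁ - B₁ * u₀) * W₁ + (u₀ * B₂ - B₂ * u₀) * W₂ = 0)
    (hY1 : (u₁ * B₀ - B₀ * u₁) * W₀ + (u₁ * B₁ - B₁ * u₁) * W₁ + (u₁ * B₂ - B₂ * u₁) * W₂ = 0)
    (hY2 : (u₂ * B₀ - B₀ * u₂) * W₀ + (u₂ * B₁ - B₁ * u₂) * W₁ + (u₂ * B₂ - B₂ * u₂) * W₂ = 0) :
    LinearMap.trace F U (σ * ((B₁ * C₂ - B₂ * C₁) * P₀ + (B₂ * C₀ - B₀ * C₂) * P₁ + (B₀ * C₁ - B₁ * C₀) * P₂))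
      = 0 := by
  rw [supertrace_cubicForm_eq_supertrace_defectPairing σ u₀ u₁ u₂ B₀ B₁ B₂ W₀ W₁ W₂ C₀ C₁ C₂ P₀ P₁ P₂
    hσ0 hσ1 hσ2 h00 h01 h02 h11 h12 h10 h22 h20 h21 hdiv, hY0, hY1, hY2]
  simp

end Summit.Ventures.HSemireg
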